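import Mathlib
import Summits.Ventures.PercRepro2.IFRTail

/-!
# Discrete IFR convolution (seat mine-b, cell pub-perc-repro2): log-concave tails are closed under the sum
of independent ℤ≥0-valued random variables — the analytic core of the series–parallel case of row B2
(max-flow tail log-concavity; conjectures/MINE-B.md §2.2′, proofs/MINE-B-FLOW-IFR-SP.md).

`Hsum F G M k = Σ_{s ∈ Icc (-M) M} pmf G s * F (k - s)` is the tail of the sum of two independent variables
with tails `F`, `G` (exact when the interval contains the support of `pmf G`).  Main theorem
`Hsum_logconcave`: `Hsum` is log-concave.  Proof: 2×2 Cauchy–Binet, summation by parts in one index, and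
the sign lemma `mixed_nonneg` (balanced pairs + hazard monotonicity) — the lattice form of Barlow–Proschan,
Statistical Theory of Reliability and Life Testing, Ch. 4 Thm 4.2.
-/

open Finset

namespace Summit.Ventures.PercRepro2.IFR

section Convolution

variable {F G : ℤ → ℝ} {NF NG M : ℤ} (hF : IsLCTail F NF) (hG : IsLCTail G NG)

open IsLCTail

/-- the index set of all sums -/
noncomputable def I (M : ℤ) : Finset ℤ := Finset.Icc (-M) M

/-- the tail of the sum: `H k = Σ_{s ∈ I} g s * F (k - s)` -/
noncomputable def Hsum (F G : ℤ → ℝ) (M : ℤ) (k : ℤ) : ℝ := ∑ s ∈ I M, pmf G s * F (k - s)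

include hG in
/-- the pmf vanishes on negative indices (the tail is `1` on `k ≤ 0`) -/
lemma pmf_vanish_neg {s : ℤ} (hs : s ≤ -1) : pmf G s = 0 := by
  unfold pmf; rw [hG.one s (by omega), hG.one (s + 1) (by omega)]; ring

include hG in
/-- the pmf vanishes from the support bound on -/
lemma pmf_vanish_top {s : ℤ} (hs : NG ≤ s) : pmf G s = 0 := by
  unfold pmf; rw [hG.vanish s hs, hG.vanish (s + 1) (by omega)]; ring

/-- shift lemma: a sum over `I M` is shift-invariant when the summand vanishes at both ends. -/
lemma sum_shift (φ : ℤ → ℝ) (h0 : φ (-M - 1) = 0) (h1 : φ M = 0) :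
    ∑ s ∈ I M, φ (s - 1) = ∑ s ∈ I M, φ s := by
  unfold I
  have himg : ∑ s ∈ Finset.Icc (-M) M, φ (s - 1) = ∑ s ∈ Finset.Icc (-M - 1) (M - 1), φ s := by
    refine Finset.sum_nbij' (fun s => s - 1) (fun s => s + 1) ?_ ?_ ?_ ?_ ?_
    · intro x hx; simp only [Finset.mem_Icc] at hx ⊢; omega
    · intro x hx; simp only [Finset.mem_Icc] at hx ⊢; omega
    · intro x _; simp
    · intro x _; simp
    · intro x _; rfl
  rw [himg]
  have hsub1 : Finset.Icc (-M) (M - 1) ⊆ Finset.Icc (-M - 1) (M - 1) :=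
    Finset.Icc_subset_Icc (by omega) le_rfl
  have hsub2 : Finset.Icc (-M) (M - 1) ⊆ Finset.Icc (-M) M :=
    Finset.Icc_subset_Icc le_rfl (by omega)
  rw [← Finset.sum_subset hsub1, ← Finset.sum_subset hsub2]
  · intro x hx hx'; simp only [Finset.mem_Icc] at hx hx'
    have : x = M := by omega
    rw [this]; exact h1
  · intro x hx hx'; simp only [Finset.mem_Icc] at hx hx'
    have : x = -M - 1 := by omega
    rw [this]; exact h0

/-- the kernel `A` of the Cauchy–Binet expansion at `(k, k+1)` -/
def Akern (F : ℤ → ℝ) (k s₁ s₂ : ℤ) : ℝ := F (k - s₁) * F (k + 1 - s₂) - F (k - s₂) * F (k + 1 - s₁)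

/-- the summed-by-parts kernel -/
def Atil (F : ℤ → ℝ) (k s₁ s₂ : ℤ) : ℝ := Akern F k s₁ s₂ - Akern F k s₁ (s₂ - 1)

/-- the summed-by-parts kernel in tail/pmf form -/
lemma Atil_eq (k s₁ s₂ : ℤ) :
    Atil F k s₁ s₂ = F (k - s₁) * pmf F (k + 1 - s₂) - F (k + 1 - s₁) * pmf F (k - s₂) := by
  unfold Atil Akern pmf
  have e1 : k + 1 - (s₂ - 1) = k + 1 - s₂ + 1 := by ring
  have e2 : k - (s₂ - 1) = k - s₂ + 1 := by ring
  rw [e1, e2]; ring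

/-- mixed sign lemma: `T x₂ * t x₃ - T x₄ * t x₁ ≥ 0` when `x₁ ≤ x₂`, `x₁ ≤ x₃`, `x₁ + x₄ = x₂ + x₃`. -/
lemma mixed_nonneg {T : ℤ → ℝ} {NT : ℤ} (hT : IsLCTail T NT) {x₁ x₂ x₃ x₄ : ℤ}
    (h12 : x₁ ≤ x₂) (h13 : x₁ ≤ x₃) (hsum : x₁ + x₄ = x₂ + x₃) :
    0 ≤ T x₂ * pmf T x₃ - T x₄ * pmf T x₁ := by
  have hbal : T x₁ * T x₄ ≤ T x₂ * T x₃ := hT.balanced4 h12 h13 hsum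
  have hhaz : pmf T x₁ * T x₃ ≤ pmf T x₃ * T x₁ := hT.hazard h13
  have hp3 := hT.pmf_nonneg x₃
  have hp1 := hT.pmf_nonneg x₁
  have hn1 := hT.nonneg x₁
  have hn2 := hT.nonneg x₂
  have hn3 := hT.nonneg x₃
  have hn4 := hT.nonneg x₄
  by_cases h3 : T x₃ = 0
  · -- then pmf x₃ = 0 and T x₁ T x₄ = 0
    have hp3z : pmf T x₃ = 0 := by
      have ha := hT.anti x₃; have hb := hT.nonneg (x₃ + 1); unfold pmf; rw [h3] at ha ⊢; linarith
    have hprod : T x₁ * T x₄ = 0 := by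
      rw [h3, mul_zero] at hbal; exact le_antisymm hbal (mul_nonneg hn1 hn4)
    rcases mul_eq_zero.mp hprod with h1 | h4
    · have hp1z : pmf T x₁ = 0 := by
        have ha := hT.anti x₁; have hb := hT.nonneg (x₁ + 1); unfold pmf; rw [h1] at ha ⊢; linarith
      rw [hp3z, hp1z]; simp
    · rw [hp3z, h4]; simp
  have hpos : 0 < T x₃ := lt_of_le_of_ne hn3 (Ne.symm h3)
  have key : 0 ≤ T x₃ * (T x₂ * pmf T x₃ - T x₄ * pmf T x₁) := by
    have e1 : T x₁ * T x₄ * pmf T x₃ ≤ T x₂ * T x₃ * pmf T x₃ := mul_le_mul_of_nonneg_right hbal hp3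
    have e2 : T x₄ * (pmf T x₁ * T x₃) ≤ T x₄ * (pmf T x₃ * T x₁) := mul_le_mul_of_nonneg_left hhaz hn4
    nlinarith [e1, e2]
  exact (mul_nonneg_iff_of_pos_left hpos).mp key


/-- the truncated kernel `Ā` (zero unless `s₁ < s₂`) -/
noncomputable def Abar (F : ℤ → ℝ) (k s₁ s₂ : ℤ) : ℝ := if s₁ < s₂ then Akern F k s₁ s₂ else 0

/-- the kernel vanishes on the diagonal -/
lemma Akern_diag (k s : ℤ) : Akern F k s s = 0 := by unfold Akern; ring

/-- the difference of consecutive truncated kernels is the summed-by-parts kernel -/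
lemma Abar_sub (k s₁ s₂ : ℤ) :
    Abar F k s₁ s₂ - Abar F k s₁ (s₂ - 1) = if s₁ < s₂ then Atil F k s₁ s₂ else 0 := by
  unfold Abar Atil
  by_cases h : s₁ < s₂
  · by_cases h' : s₁ < s₂ - 1
    · simp only [if_pos h, if_pos h']
    · simp only [if_pos h, if_neg h']
      rw [show s₂ - 1 = s₁ by omega, Akern_diag, sub_zero]
  · have h' : ¬ s₁ < s₂ - 1 := by omega
    simp only [if_neg h, if_neg h']; ring

/-- the truncated kernel vanishes unless `s₁ < s₂` -/
lemma Abar_of_not_lt (k s₁ s₂ : ℤ) (h : ¬ s₁ < s₂) : Abar F k s₁ s₂ = 0 := by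
  unfold Abar; simp [h]

include hG in
/-- summation by parts in `s₂` -/
lemma abel (hM : NG + 1 ≤ M) (k s₁ : ℤ) (hs₁ : s₁ ∈ I M) (u : ℤ) (hu : 0 ≤ u) (hu1 : u ≤ 1) :
    ∑ s₂ ∈ I M, Abar F k s₁ s₂ * pmf G (s₂ - u)
      = ∑ s₂ ∈ I M, (if s₁ < s₂ then Atil F k s₁ s₂ else 0) * G (s₂ - u) := by
  have hs₁' : -M ≤ s₁ := by
    unfold I at hs₁; simp only [Finset.mem_Icc] at hs₁; exact hs₁.1
  have e : ∀ s₂, Abar F k s₁ s₂ * pmf G (s₂ - u)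
      = Abar F k s₁ s₂ * G (s₂ - u) - Abar F k s₁ s₂ * G (s₂ - u + 1) := by
    intro s₂; unfold pmf; ring
  rw [Finset.sum_congr rfl (fun s₂ _ => e s₂), Finset.sum_sub_distrib]
  have hb0 : (fun s => Abar F k s₁ s * G (s + 1 - u)) (-M - 1) = 0 := by
    show Abar F k s₁ (-M - 1) * G (-M - 1 + 1 - u) = 0
    rw [Abar_of_not_lt (F := F) k s₁ (-M - 1) (by omega)]; ring
  have hb1 : (fun s => Abar F k s₁ s * G (s + 1 - u)) M = 0 := by
    show Abar F k s₁ M * G (M + 1 - u) = 0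
    rw [hG.vanish (M + 1 - u) (by omega)]; ring
  have hsh := sum_shift (M := M) (fun s => Abar F k s₁ s * G (s + 1 - u)) hb0 hb1
  have hshift : ∑ s₂ ∈ I M, Abar F k s₁ s₂ * G (s₂ - u + 1)
      = ∑ s₂ ∈ I M, Abar F k s₁ (s₂ - 1) * G (s₂ - u) := by
    have hl : ∑ s₂ ∈ I M, Abar F k s₁ s₂ * G (s₂ - u + 1)
        = ∑ s ∈ I M, (fun s => Abar F k s₁ s * G (s + 1 - u)) s := by
      refine Finset.sum_congr rfl (fun s _ => ?_)
      show Abar F k s₁ s * G (s - u + 1) = Abar F k s₁ s * G (s + 1 - u)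
      have e1 : s - u + 1 = s + 1 - u := by ring
      rw [e1]
    have hr : ∑ s ∈ I M, (fun s => Abar F k s₁ s * G (s + 1 - u)) (s - 1)
        = ∑ s₂ ∈ I M, Abar F k s₁ (s₂ - 1) * G (s₂ - u) := by
      refine Finset.sum_congr rfl (fun s _ => ?_)
      show Abar F k s₁ (s - 1) * G (s - 1 + 1 - u) = Abar F k s₁ (s - 1) * G (s - u)
      have e1 : s - 1 + 1 - u = s - u := by ring
      rw [e1]
    rw [hl, ← hsh, hr]
  rw [hshift, ← Finset.sum_sub_distrib]
  refine Finset.sum_congr rfl (fun s₂ _ => ?_)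
  rw [← sub_mul, Abar_sub]

include hF hG in
/-- **Discrete IFR convolution**: the tail `Hsum` of the sum of two independent IFR variables is log-concave. -/
theorem Hsum_logconcave (hM : NG + 1 ≤ M) (hM0 : 0 ≤ M) (k : ℤ) :
    Hsum F G M (k - 1) * Hsum F G M (k + 1) ≤ Hsum F G M k * Hsum F G M k := by
  have cb := cauchy_binet_two (I M) (fun s => F (k - s)) (fun s => F (k + 1 - s))
    (fun s => pmf G s) (fun s => pmf G (s - 1))
  have h1 : ∑ s ∈ I M, F (k - s) * pmf G s = Hsum F G M k := by
    unfold Hsum; exact Finset.sum_congr rfl (fun s _ => by ring)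
  have h2 : ∑ s ∈ I M, F (k + 1 - s) * pmf G (s - 1) = Hsum F G M k := by
    have hb0 : (fun s => pmf G s * F (k - s)) (-M - 1) = 0 := by
      show pmf G (-M - 1) * F (k - (-M - 1)) = 0
      rw [pmf_vanish_neg hG (by omega)]; ring
    have hb1 : (fun s => pmf G s * F (k - s)) M = 0 := by
      show pmf G M * F (k - M) = 0
      rw [pmf_vanish_top hG (by omega)]; ring
    have hsh := sum_shift (M := M) (fun s => pmf G s * F (k - s)) hb0 hb1
    unfold Hsum; rw [← hsh]
    refine Finset.sum_congr rfl (fun s _ => ?_)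
    show F (k + 1 - s) * pmf G (s - 1) = pmf G (s - 1) * F (k - (s - 1))
    have e1 : k - (s - 1) = k + 1 - s := by ring
    rw [e1]; ring
  have h3 : ∑ s ∈ I M, F (k - s) * pmf G (s - 1) = Hsum F G M (k - 1) := by
    have hb0 : (fun s => pmf G s * F (k - 1 - s)) (-M - 1) = 0 := by
      show pmf G (-M - 1) * F (k - 1 - (-M - 1)) = 0
      rw [pmf_vanish_neg hG (by omega)]; ring
    have hb1 : (fun s => pmf G s * F (k - 1 - s)) M = 0 := by
      show pmf G M * F (k - 1 - M) = 0
      rw [pmf_vanish_top hG (by omega)]; ring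
    have hsh := sum_shift (M := M) (fun s => pmf G s * F (k - 1 - s)) hb0 hb1
    unfold Hsum; rw [← hsh]
    refine Finset.sum_congr rfl (fun s _ => ?_)
    show F (k - s) * pmf G (s - 1) = pmf G (s - 1) * F (k - 1 - (s - 1))
    have e1 : k - 1 - (s - 1) = k - s := by ring
    rw [e1]; ring
  have h4 : ∑ s ∈ I M, F (k + 1 - s) * pmf G s = Hsum F G M (k + 1) := by
    unfold Hsum; exact Finset.sum_congr rfl (fun s _ => by ring)
  rw [h1, h2, h3, h4] at cb
  suffices hpos : 0 ≤ ∑ s₁ ∈ I M, ∑ s₂ ∈ (I M).filter (fun s₂ => s₁ < s₂),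
      (F (k - s₁) * F (k + 1 - s₂) - F (k - s₂) * F (k + 1 - s₁)) *
        (pmf G s₁ * pmf G (s₂ - 1) - pmf G s₂ * pmf G (s₁ - 1)) by linarith [cb, hpos]
  apply Finset.sum_nonneg
  intro s₁ hs₁
  rw [Finset.sum_filter]
  have e : ∀ s₂ ∈ I M, (if s₁ < s₂ then (F (k - s₁) * F (k + 1 - s₂) - F (k - s₂) * F (k + 1 - s₁)) *
        (pmf G s₁ * pmf G (s₂ - 1) - pmf G s₂ * pmf G (s₁ - 1)) else 0)
      = pmf G s₁ * (Abar F k s₁ s₂ * pmf G (s₂ - 1)) - pmf G (s₁ - 1) * (Abar F k s₁ s₂ * pmf G s₂) := by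
    intro s₂ _
    by_cases h : s₁ < s₂
    · rw [if_pos h]; unfold Abar; rw [if_pos h]; unfold Akern; ring
    · rw [if_neg h]; unfold Abar; rw [if_neg h]; ring
  rw [Finset.sum_congr rfl e, Finset.sum_sub_distrib, ← Finset.mul_sum, ← Finset.mul_sum]
  have a1 := abel (F := F) hG hM k s₁ hs₁ 1 (by norm_num) le_rfl
  have a0 := abel (F := F) hG hM k s₁ hs₁ 0 le_rfl (by norm_num)
  simp only [sub_zero] at a0
  rw [a1, a0, Finset.mul_sum, Finset.mul_sum, ← Finset.sum_sub_distrib]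
  apply Finset.sum_nonneg
  intro s₂ _
  by_cases h : s₁ < s₂
  · simp only [h, if_true]
    have hA : 0 ≤ Atil F k s₁ s₂ := by
      rw [Atil_eq]
      exact mixed_nonneg hF (x₁ := k - s₂) (x₂ := k - s₁) (x₃ := k + 1 - s₂) (x₄ := k + 1 - s₁)
        (by omega) (by omega) (by ring)
    have hB : 0 ≤ G (s₂ - 1) * pmf G s₁ - G s₂ * pmf G (s₁ - 1) :=
      mixed_nonneg hG (x₁ := s₁ - 1) (x₂ := s₂ - 1) (x₃ := s₁) (x₄ := s₂) (by omega) (by omega) (by ring)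
    have : pmf G s₁ * (Atil F k s₁ s₂ * G (s₂ - 1)) - pmf G (s₁ - 1) * (Atil F k s₁ s₂ * G s₂)
        = Atil F k s₁ s₂ * (G (s₂ - 1) * pmf G s₁ - G s₂ * pmf G (s₁ - 1)) := by ring
    rw [this]; exact mul_nonneg hA hB
  · simp [h]

end Convolution

end Summit.Ventures.PercRepro2.IFR
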